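import Literature.AnabelianGeometry.EtaleTheta.RealifiedDivisorMonoidsOfRlf

/-!
# [EtTh] Definition 3.6 (i): the realified data CONSTRUCTED for the monoid type `Λ = ℝ`
# (`B₀^ℝ := ℝ·Φ₀^birat`, `F₀^ℝ := ℝ·Φ₀^cnst`) — `RealifiedDivisorMonoids.ofRlfR`

Mochizuki, *The étale theta function …*, Publ. RIMS **45** (2009), Def. 3.6 (i), PDF p.76
[cite: MochizukiEtTh2009, Def 3.6 p.76]: "`ℝ·Φ₀^birat ⊆ (Φ₀^ℝ)^gp`, `ℝ·Φ₀^cnst ⊆ (Φ₀^ℝ)^gp` for the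
`ℝ`-vector subspaces generated by `Φ₀^birat`, `Φ₀^cnst`"; "`B₀^Λ` for … `ℝ·Φ₀^birat` if `Λ = ℝ`",
"`F₀^Λ ⊆ B₀^Λ` for … `ℝ·Φ₀^cnst`".  Sequel to `RealifiedDivisorMonoidsOfRlf.lean` (`ofRlfZ`, `Λ = ℤ`;
abc-iut cell ROW `EtTh:Def3.6(i) ofRlf`, seat abc-iut-L6-t12): the same realification block and the
same `ℝ·Φ₀^cnst`, with `B₀^ℝ := ℝ·Φ₀^birat` — the `ℝ`-span (abc-iut-L1-t5's `RealificationData.realSpan`)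
of the subfunctor of groups `Φ₀^birat` generated by "the image of `B₀ → Φ₀^gp`" (Def. 3.3 (iii)),
regarded as a group-like monoid on `D₀` with its inclusion into `(Φ₀^ℝ)^gp` (`GpSubfunctor.toMonoid`,
`GpSubfunctor.incl`) — and `F₀^ℝ := ℝ·Φ₀^cnst` as a submonoid of `B₀^ℝ`.  Every field of abc-iut-L2-t3's
`RealifiedDivisorMonoids` is proved; only hypothesis: Prop. 3.4 (i) (`Φ₀(Y)` perf-factorial).
-/

noncomputable section

namespace Literature.AnabelianGeometry.EtaleTheta

open CategoryTheory Opposite Literature.AlgebraicGeometry.Frobenioids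

universe u v w

namespace DivisorMonoids

variable {D₀ : Type u} [Category.{v} D₀] (T : DivisorMonoids.{u, v, w} D₀)

/-- **`Φ₀^birat` as a subfunctor of groups of `Φ₀^gp`**: objectwise the subgroup of `Φ₀(Y)^gp`
generated by "the image `Φ₀^birat` of `B₀ → Φ₀^gp`" (Def. 3.3 (iii), p.73; `B₀` is a group of functions),
stable under pull-back by the naturality of `B₀ → Φ₀^gp`. [cite: MochizukiEtTh2009, Def 3.3 p.73] -/
def biratGp : GpSubfunctor T.Φ₀ where
  carrier X := Subgroup.closure (T.birat (op X) : Set (Algebra.GrothendieckGroup (T.Φ₀.obj (op X))))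
  pull_mem := by
    intro X Y f c hc
    have hle : (Subgroup.closure (T.birat (op Y) : Set _)).map (pullGp T.Φ₀ f) ≤
        Subgroup.closure (T.birat (op X) : Set _) := by
      rw [MonoidHom.map_closure]
      apply Subgroup.closure_mono
      rintro _ ⟨x, ⟨b, rfl⟩, rfl⟩
      refine ⟨(T.B₀.map f.op).hom b, ?_⟩
      change T.div₀ (op X) ((T.B₀.map f.op).hom b) = MonGp.map (T.Φ₀.map f.op).hom (T.div₀ (op Y) b)
      rw [T.div₀_natural f.op b, gpMap_eq_monGpMap]
    exact hle (Subgroup.mem_map_of_mem _ hc)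

/-- `Φ₀^cnst ⊆ Φ₀^birat` at the level of the generated subfunctors of groups.
[cite: MochizukiEtTh2009, Def 3.3 p.73] -/
theorem cnstGp_le_biratGp (X : D₀) : T.cnstGp.carrier X ≤ T.biratGp.carrier X :=
  Subgroup.closure_mono (T.cnst_le_birat (op X))

end DivisorMonoids

namespace RealifiedDivisorMonoids

variable {D₀ : Type u} [Category.{v} D₀] (dm : DivisorMonoids.{u, v, w} D₀)
  (hpf : ∀ Y : D₀ᵒᵖ, IsPerfFactorial (dm.Φ₀.obj Y))

/-- `ℝ·Φ₀^cnst ⊆ ℝ·Φ₀^birat` (spans are monotone). [cite: MochizukiEtTh2009, Def 3.6 p.76] -/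
theorem realSpan_cnstGp_le_realSpan_biratGp (X : D₀) :
    ((realData dm hpf).realSpan dm.cnstGp).carrier X ≤ ((realData dm hpf).realSpan dm.biratGp).carrier X := by
  apply Subgroup.closure_mono
  rintro _ ⟨r, c, hc, rfl⟩
  exact ⟨r, c, dm.cnstGp_le_biratGp X hc, rfl⟩

/-- **Definition 3.6 (i) for the monoid type `Λ = ℝ`, CONSTRUCTED**: as `ofRlfZ`, but with
`B₀^ℝ := ℝ·Φ₀^birat ⊆ (Φ₀^ℝ)^gp` (the `ℝ`-span of `Φ₀^birat`, a group-like monoid on `D₀` with its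
inclusion as `B₀^ℝ → (Φ₀^ℝ)^gp`) and `F₀^ℝ := ℝ·Φ₀^cnst` (as a submonoid of `B₀^ℝ`); every axiom of the
interface is proved. [cite: MochizukiEtTh2009, Def 3.6 p.76] -/
def ofRlfR : RealifiedDivisorMonoids (D₀ := D₀) treeMonoidVocab.{w} where
  toDivisorMonoids := dm
  Λ := MonoidType.R
  ΦR := rlfFunctor dm.Φ₀ hpf
  toR Y := ((toRlfNatTrans dm.Φ₀ hpf).app Y).hom
  toR_natural f x := (rlfMap_toRealification_of dm.Φ₀ hpf f x).symm
  isRealification Y := isRealificationVia_toRealification (hpf Y)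
  BΛ := ((realData dm hpf).realSpan dm.biratGp).toMonoid
  isUnit_BΛ Y b := ((realData dm hpf).realSpan dm.biratGp).isUnit_toMonoid Y b
  divΛ Y := (((realData dm hpf).realSpan dm.biratGp).incl.app Y).hom
  divΛ_natural {Y Y'} f b := by
    rw [gpMap_eq_monGpMap]
    rfl
  FΛ Y := ((realData dm hpf).realSpan dm.cnstGp).carrier (unop Y) |>.toSubmonoid.comap
    (((realData dm hpf).realSpan dm.biratGp).carrier (unop Y)).subtype
  FΛ_map {Y Y'} f b hb := ((realData dm hpf).realSpan dm.cnstGp).pull_mem f.unop hb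
  cnstR Y := ((realData dm hpf).realSpan dm.cnstGp).carrier (unop Y)
  cnstR_map {Y Y'} f x hx := by
    have h := ((realData dm hpf).realSpan dm.cnstGp).pull_mem f.unop hx
    rwa [pullGp, ← gpMap_eq_monGpMap] at h
  divΛ_mem_cnstR Y b hb := hb
  cnstR_root Y g n hg := RealificationDataLemmas.mem_realSpan_of_pow_mem _ _ (unop Y) n.pos hg
  cnst_le_cnstR Y b hb := by
    change gpMap ((toRlfNatTrans dm.Φ₀ hpf).app Y).hom (dm.div₀ Y b) ∈
      ((realData dm hpf).realSpan dm.cnstGp).carrier (unop Y)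
    rw [← toRlfGp_realData_eq]
    exact (realData dm hpf).toRlfGp_mem_realSpan dm.cnstGp (unop Y)
      (dm.mem_cnstGp_of_mem_cnst (unop Y) ⟨b, hb, rfl⟩)
  ncspR Y := rlfSuppIn (hpf Y) (toRSuppOf dm hpf Y (dm.ncsp₀ Y))
  cspR Y := rlfSuppIn (hpf Y) (toRSuppOf dm hpf Y (dm.csp₀ Y))
  toR_ncsp Y x hx := supp_toR_subset_toRSuppOf dm hpf Y hx
  toR_csp Y x hx := supp_toR_subset_toRSuppOf dm hpf Y hx

/-- The monoid type of `ofRlfR` is `ℝ`. [cite: MochizukiEtTh2009, Def 3.6 p.76] -/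
@[simp] theorem ofRlfR_Λ : (ofRlfR dm hpf).Λ = MonoidType.R := rfl

/-- `Φ₀^ℝ` of `ofRlfR` is the realification functor. [cite: MochizukiEtTh2009, Def 3.6 p.76] -/
@[simp] theorem ofRlfR_ΦR : (ofRlfR dm hpf).ΦR = rlfFunctor dm.Φ₀ hpf := rfl

/-- `B₀^ℝ := ℝ·Φ₀^birat` as a monoid on `D₀`. [cite: MochizukiEtTh2009, Def 3.6 p.76] -/
theorem ofRlfR_BΛ : (ofRlfR dm hpf).BΛ = ((realData dm hpf).realSpan dm.biratGp).toMonoid := rfl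

/-- `ℝ·Φ₀^cnst` of `ofRlfR` agrees with that of `ofRlfZ` (the `ℝ`-span of `Φ₀^cnst`).
[cite: MochizukiEtTh2009, Def 3.6 p.76] -/
theorem ofRlfR_cnstR (Y : D₀ᵒᵖ) : (ofRlfR dm hpf).cnstR Y = (ofRlfZ dm hpf).cnstR Y := rfl

/-- The data `ofRlfR` and `ofRlfZ` share the Def. 3.3 (iii) part and the realification block
(only `Λ`, `B₀^Λ`, `F₀^Λ` differ). [cite: MochizukiEtTh2009, Def 3.6 p.76] -/
theorem ofRlfR_toDivisorMonoids : (ofRlfR dm hpf).toDivisorMonoids = (ofRlfZ dm hpf).toDivisorMonoids := rfl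

end RealifiedDivisorMonoids

end Literature.AnabelianGeometry.EtaleTheta

end
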